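import Summits.SmoothPoincare4.SmoothPoincare4.Theorems.CongruenceShadowsAgkCor6SufficiencySpineDefs
import Summits.SmoothPoincare4.SmoothPoincare4.Theorems.CongruenceShadowsAgkCor6SufficiencyStubSeamFormCalc
import Literature.Topology.FourManifolds.TrisectionsAmbientMorseLemmas
import Literature.Topology.FourManifolds.RegularSublevelSet

/-!
# Helpers for stub `stub_seamForm` of line `lp-by-sphere-system-surgery` (crux `AgkCor6Sufficiency`,
item stmt-SmoothPoincare4-10894, routes CongruenceShadows / GroupTrisection; lead reshape r5, A3):
the tube part

Uniform-in-`m` algebra of the seam coordinates `(p, q) = (pCo m (u, v), qCo m (u, v))` of the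
three seams (in these coordinates the reference sector of seam `m` is the quadrant
`{p, q ≥ 0}`, the normalised one is `{q ≤ 0, q ≤ p}`, the seam is the ray `{q = 0, p ≥ 0}`), and
the regularity of functions of `(p, q)` at points of the tube `Ot` of a tube structure, read in
a corner-slice chart along the transverse line `q ↦ q + s` (`not_isMCriticalPt_of_tubeLine`):
the reference presentation `1 - 2pq` is regular where `p ≠ 0` (`sigma_regular_tube`), the
normalised one `1 + 2pq - 2q²` where `2|q| < p` (`norm_regular_tube`), and the
seam-modified normalised presentation `Gn + τ(p)ψ(σ)(1 - σ - Gn)` is regular on the box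
`{p > r₀, |q| < r₀ / 2}` (`modified_regular_tube`, by `tubeProfile_deriv_pos`).  Bundled in the
registered helper stub `stub_seamFormTubeToolkit : SeamFormTubeToolkit`.

## References

* A. Abrams, D. Gay, R. Kirby, *Group trisections and smooth 4-manifolds*, Geom. Topol. 22
  (2018), proof of Thm. 5. [AbramsGayKirby2018]
* D. Gay, R. Kirby, *Trisecting 4-manifolds*, Geom. Topol. 20 (2016), Def. 1. [GayKirby2016]
-/

noncomputable section

-- the prescribed namespace `Summit.<P>.<Sub>.…` duplicates `SmoothPoincare4` (P = Sub)
set_option linter.dupNamespace false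

open Set Function Filter Metric
open scoped Manifold ContDiff Topology

namespace Summit.SmoothPoincare4.SmoothPoincare4.Cruxes.AgkCor6Sufficiency.LpBySphereSystemSurgery

open Literature.Topology.FourManifolds

/-! ## Algebra of the seam coordinates -/

section Algebra

/-- `p² ≤ u² + v²`. -/
theorem pCo_sq_le (m : Fin 3) (a b : ℝ) : pCo m a b ^ 2 ≤ a ^ 2 + b ^ 2 := by
  fin_cases m <;> simp [pCo] <;> nlinarith [sq_nonneg a, sq_nonneg b]

/-- `u² + v² ≤ p² + (p + |q|)²` for `p ≥ 0`. -/
theorem normSq_le (m : Fin 3) (a b : ℝ) (hp : 0 ≤ pCo m a b) :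
    a ^ 2 + b ^ 2 ≤ pCo m a b ^ 2 + (pCo m a b + |qCo m a b|) ^ 2 := by
  fin_cases m <;> simp [pCo, qCo] at hp ⊢
  · cases abs_cases (b - a) <;> nlinarith
  · cases abs_cases b <;> nlinarith
  · cases abs_cases a <;> nlinarith

/-- On the box `{p > r₀, |q| < r₀ / 2}` outside the `9 r₀`-disc one has `p > 6 r₀`. -/
theorem six_lt_pCo {m : Fin 3} {a b r₀ : ℝ} (hr₀ : 0 < r₀) (hp : r₀ < pCo m a b)
    (hq : |qCo m a b| < r₀ / 2) (hab : (9 * r₀) ^ 2 ≤ a ^ 2 + b ^ 2) : 6 * r₀ < pCo m a b := by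
  have h := normSq_le m a b (by linarith)
  by_contra hle
  have hle' : pCo m a b ≤ 6 * r₀ := not_lt.1 hle
  have h1 : pCo m a b + |qCo m a b| < 6 * r₀ + r₀ / 2 := by linarith
  have h2 : (pCo m a b + |qCo m a b|) ^ 2 < (6 * r₀ + r₀ / 2) ^ 2 := by
    have h0 : 0 ≤ pCo m a b + |qCo m a b| := by linarith [abs_nonneg (qCo m a b)]
    nlinarith
  nlinarith

/-- Below `p ≤ r₀` with `|q| ≤ r₀ / 2` one is inside the `5 r₀`-disc (indeed `u² + v² < 4 r₀²`). -/
theorem normSq_lt_of_pCo_le {m : Fin 3} {a b r₀ : ℝ} (hr₀ : 0 < r₀) (hp0 : 0 ≤ pCo m a b)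
    (hp : pCo m a b ≤ r₀) (hq : |qCo m a b| ≤ r₀ / 2) : a ^ 2 + b ^ 2 < (4 * r₀) ^ 2 := by
  have h := normSq_le m a b hp0
  have h1 : (pCo m a b + |qCo m a b|) ^ 2 ≤ (r₀ + r₀ / 2) ^ 2 := by
    have h0 : 0 ≤ pCo m a b + |qCo m a b| := by linarith [abs_nonneg (qCo m a b)]
    nlinarith
  nlinarith

/-- The transverse direction of seam `m` in a corner-slice chart (`∂_q`: `e₁` for `m = 0, 1`,
`e₀` for `m = 2`; moving along it keeps `p` fixed and adds `s` to `q`). -/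
def seamDir (m : Fin 3) : EuclideanSpace ℝ (Fin 4) :=
  if m = 2 then EuclideanSpace.single 0 1 else EuclideanSpace.single 1 1

/-- Along the transverse direction, `p` is constant. -/
theorem pCo_line (m : Fin 3) (z : EuclideanSpace ℝ (Fin 4)) (s : ℝ) :
    pCo m ((z + s • seamDir m) 0) ((z + s • seamDir m) 1) = pCo m (z 0) (z 1) := by
  fin_cases m <;> simp [seamDir, pCo]

/-- Along the transverse direction, `q` increases by `s`. -/
theorem qCo_line (m : Fin 3) (z : EuclideanSpace ℝ (Fin 4)) (s : ℝ) :
    qCo m ((z + s • seamDir m) 0) ((z + s • seamDir m) 1) = qCo m (z 0) (z 1) + s := by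
  fin_cases m
  · simp [seamDir, qCo]; ring
  · simp [seamDir, qCo]
  · simp [seamDir, qCo]

/-- The seam coordinate `p` is a continuous function of the point. -/
theorem continuous_pCo_comp {X : Type} [TopologicalSpace X] (m : Fin 3) {u v : X → ℝ}
    (hu : Continuous u) (hv : Continuous v) :
    Continuous fun x => pCo m (u x) (v x) := by
  fin_cases m
  · show Continuous fun x => -u x
    exact hu.neg
  · exact hu
  · exact hv

/-- The seam coordinate `q` is a continuous function of the point. -/
theorem continuous_qCo_comp {X : Type} [TopologicalSpace X] (m : Fin 3) {u v : X → ℝ}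
    (hu : Continuous u) (hv : Continuous v) :
    Continuous fun x => qCo m (u x) (v x) := by
  fin_cases m
  · show Continuous fun x => v x - u x
    exact hv.sub hu
  · exact hv
  · exact hu

end Algebra

/-! ## The wedges in seam coordinates -/

section Wedges

variable {X : Type} [TopologicalSpace X] [ChartedSpace (EuclideanSpace ℝ (Fin 4)) X]
  {S : Fin 3 → Set X} {u v : X → ℝ} {ρ : X → X} {U O : Set X} {c : Fin 3 → ℕ → ℕ}

/-- In `U`, the reference sector of seam `m` is the quadrant `{p ≥ 0, q ≥ 0}`. -/
theorem mem_ref_iff (hT : TriNormalForm S 0 1 2 u v ρ U O c) (m : Fin 3) {x : X} (hx : x ∈ U) :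
    x ∈ S (refIdx m) ↔ 0 ≤ pCo m (u x) (v x) ∧ 0 ≤ qCo m (u x) (v x) := by
  fin_cases m
  · show x ∈ S 1 ↔ _
    rw [hT.mem_j x hx]; simp [pCo, qCo]
  · show x ∈ S 0 ↔ _
    rw [hT.mem_i x hx]; simp [pCo, qCo]
  · show x ∈ S 0 ↔ _
    rw [hT.mem_i x hx]; simp [pCo, qCo]; exact and_comm

/-- In `U`, the normalised sector of seam `m` is the wedge `{q ≤ 0, q ≤ p}`. -/
theorem mem_norm_iff (hT : TriNormalForm S 0 1 2 u v ρ U O c) (m : Fin 3) {x : X} (hx : x ∈ U) :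
    x ∈ S (normIdx m) ↔ qCo m (u x) (v x) ≤ 0 ∧ qCo m (u x) (v x) ≤ pCo m (u x) (v x) := by
  fin_cases m
  · show x ∈ S 2 ↔ _
    rw [hT.mem_l x hx]; simp [pCo, qCo]; exact and_comm
  · show x ∈ S 2 ↔ _
    rw [hT.mem_l x hx]; simp [pCo, qCo]
  · show x ∈ S 1 ↔ _
    rw [hT.mem_j x hx]; simp [pCo, qCo]

/-- In `U`, the seam `S (m+1) ∩ S (m+2)` is the ray `{q = 0, p ≥ 0}`. -/
theorem mem_seam_iff (hT : TriNormalForm S 0 1 2 u v ρ U O c) (m : Fin 3) {x : X} (hx : x ∈ U) :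
    x ∈ S (refIdx m) ∩ S (normIdx m) ↔ qCo m (u x) (v x) = 0 ∧ 0 ≤ pCo m (u x) (v x) := by
  rw [mem_inter_iff, mem_ref_iff hT m hx, mem_norm_iff hT m hx]
  constructor
  · rintro ⟨⟨h1, h2⟩, h3, -⟩; exact ⟨le_antisymm h3 h2, h1⟩
  · rintro ⟨h1, h2⟩; rw [h1]; exact ⟨⟨h2, le_rfl⟩, le_rfl, h2⟩

end Wedges

/-! ## Regularity of functions of `(p, q)` at tube points -/

section TubeLine

variable {X : Type} [TopologicalSpace X] [ChartedSpace (EuclideanSpace ℝ (Fin 4)) X]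
  {S₀ F : Set X} {u v : X → ℝ} {ρ : X → X} {O Ot : Set X} {rt : ℝ} {tp : X → ℝ → ℝ → X}

/-- **Every tube point lies in a corner-slice chart** (`tp_self` and the chart formula of the
tube structure at `ρ x ∈ F`). -/
theorem exists_cornerChart_of_mem (hTS : TubeStructure S₀ F u v ρ O Ot rt tp)
    (hρF : ∀ x ∈ Ot, ρ x ∈ F) {x : X} (hx : x ∈ Ot) :
    ∃ C : CornerSliceChart S₀ F u v ρ, x ∈ C.Θ.source := by
  obtain ⟨C, W, -, hpW, -, -, hch⟩ := hTS.chart (ρ x) (hρF x hx)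
  obtain ⟨htgt, heq⟩ := hch (ρ x) hpW (hρF x hx) (u x) (v x) (hTS.sq_lt x hx)
  refine ⟨C, ?_⟩
  rw [← hTS.tp_self x hx, heq]
  exact C.Θ.map_target htgt

/-- **Regularity along the transverse line in the tube.**  Let `f` be smooth and, near the tube
point `x`, a function `Φ(p, q)` of the seam coordinates of `m`; if `s ↦ Φ(p(x), q(x) + s)` has
nonzero derivative at `0`, then `x` is not a critical point of `f` (read `f` in a corner-slice
chart at `x`, where `u, v` are the first two coordinates, and move along `seamDir m`).
[cite: AbramsGayKirby2018, proof of Thm. 5] -/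
theorem not_isMCriticalPt_of_tubeLine [IsManifold (𝓡 4) ∞ X]
    (hTS : TubeStructure S₀ F u v ρ O Ot rt tp) (hρF : ∀ x ∈ Ot, ρ x ∈ F) (m : Fin 3)
    {f : X → ℝ} (hf : ContMDiff (𝓡 4) 𝓘(ℝ, ℝ) ∞ f) {x : X} (hx : x ∈ Ot) {Φ : ℝ → ℝ → ℝ}
    (hfΦ : ∀ᶠ y in 𝓝 x, f y = Φ (pCo m (u y) (v y)) (qCo m (u y) (v y))) {Φ' : ℝ}
    (hΦ' : Φ' ≠ 0)
    (hderiv : HasDerivAt (fun s : ℝ => Φ (pCo m (u x) (v x)) (qCo m (u x) (v x) + s)) Φ' 0) :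
    ¬ IsMCriticalPt (𝓡 4) f x := by
  obtain ⟨C, hxC⟩ := exists_cornerChart_of_mem hTS hρF hx
  rw [isMCriticalPt_iff_fderiv_comp_symm_eq_zero C.contMDiffOn_toFun C.contMDiffOn_symm hxC
    (hf.mdifferentiableAt (by simp))]
  have hzT : C.Θ x ∈ C.Θ.target := C.Θ.map_source hxC
  have hfd : DifferentiableAt ℝ (f ∘ C.Θ.symm) (C.Θ x) := by
    have h1 : ContDiffOn ℝ ∞ (f ∘ C.Θ.symm) C.Θ.target :=
      contMDiffOn_iff_contDiffOn.1 (hf.comp_contMDiffOn C.contMDiffOn_symm)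
    exact ((h1 _ hzT).contDiffAt (C.Θ.open_target.mem_nhds hzT)).differentiableAt (by simp)
  refine fderiv_ne_zero_of_eventuallyEq_line (v := seamDir m) hfd hderiv hΦ' ?_
  have hcont : Tendsto (fun s : ℝ => C.Θ x + s • seamDir m) (𝓝 0) (𝓝 (C.Θ x)) := by
    have : Continuous fun s : ℝ => C.Θ x + s • seamDir m := by fun_prop
    simpa using this.tendsto 0
  have h1 : ∀ᶠ s in 𝓝 (0:ℝ), C.Θ x + s • seamDir m ∈ C.Θ.target :=
    hcont.eventually (C.Θ.open_target.mem_nhds hzT)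
  have hsymm : Tendsto (fun s : ℝ => C.Θ.symm (C.Θ x + s • seamDir m)) (𝓝 0) (𝓝 x) := by
    have h := (C.Θ.continuousAt_symm hzT).tendsto.comp hcont
    rwa [C.Θ.left_inv hxC] at h
  have h2 := hsymm.eventually hfΦ
  refine Filter.Eventually.filter_mono nhdsWithin_le_nhds ?_
  filter_upwards [h1, h2] with s hs1 hs2
  have hsrc : C.Θ.symm (C.Θ x + s • seamDir m) ∈ C.Θ.source := C.Θ.map_target hs1
  have hu : u (C.Θ.symm (C.Θ x + s • seamDir m)) = (C.Θ x + s • seamDir m) 0 := by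
    rw [← C.apply_zero _ hsrc, C.Θ.right_inv hs1]
  have hv : v (C.Θ.symm (C.Θ x + s • seamDir m)) = (C.Θ x + s • seamDir m) 1 := by
    rw [← C.apply_one _ hsrc, C.Θ.right_inv hs1]
  rw [comp_apply, hs2, hu, hv, pCo_line, qCo_line, C.apply_zero x hxC, C.apply_one x hxC]

/-- **The reference presentation is regular in the tube off `p = 0`**: if `Gr = 1 - 2 p q` near
the tube point `x` (a unit form in seam coordinates) and `p(x) ≠ 0`, then `x` is not a critical
point of `Gr`. [cite: AbramsGayKirby2018, proof of Thm. 5] -/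
theorem sigma_regular_tube [IsManifold (𝓡 4) ∞ X]
    (hTS : TubeStructure S₀ F u v ρ O Ot rt tp) (hρF : ∀ x ∈ Ot, ρ x ∈ F) (m : Fin 3)
    {Gr : X → ℝ} (hGr : ContMDiff (𝓡 4) 𝓘(ℝ, ℝ) ∞ Gr) {x : X} (hx : x ∈ Ot)
    (hform : ∀ᶠ y in 𝓝 x, Gr y = 1 - 2 * pCo m (u y) (v y) * qCo m (u y) (v y))
    (hp : pCo m (u x) (v x) ≠ 0) : ¬ IsMCriticalPt (𝓡 4) Gr x := by
  refine not_isMCriticalPt_of_tubeLine hTS hρF m hGr hx (Φ := fun p q => 1 - 2 * p * q) hform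
    (Φ' := -2 * pCo m (u x) (v x)) (by simpa using hp) ?_
  have h := (((hasDerivAt_id (0:ℝ)).const_add (qCo m (u x) (v x))).const_mul
    (2 * pCo m (u x) (v x))).const_sub 1
  exact h.congr_deriv (by ring)

/-- **The normalised presentation is regular in the tube where `2|q| < p`**: if
`Gn = 1 + 2pq - 2q²` near the tube point `x` and `2|q(x)| < p(x)`, then `x` is not a critical
point of `Gn` (the transverse derivative is `2p - 4q > 0`). [cite: AbramsGayKirby2018, proof of Thm. 5] -/
theorem norm_regular_tube [IsManifold (𝓡 4) ∞ X]
    (hTS : TubeStructure S₀ F u v ρ O Ot rt tp) (hρF : ∀ x ∈ Ot, ρ x ∈ F) (m : Fin 3)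
    {Gn : X → ℝ} (hGn : ContMDiff (𝓡 4) 𝓘(ℝ, ℝ) ∞ Gn) {x : X} (hx : x ∈ Ot)
    (hform : ∀ᶠ y in 𝓝 x, Gn y =
      1 + 2 * pCo m (u y) (v y) * qCo m (u y) (v y) - 2 * qCo m (u y) (v y) ^ 2)
    (hpq : 2 * |qCo m (u x) (v x)| < pCo m (u x) (v x)) : ¬ IsMCriticalPt (𝓡 4) Gn x := by
  set p := pCo m (u x) (v x) with hp
  set q := qCo m (u x) (v x) with hq
  have hlin : HasDerivAt (fun s : ℝ => q + s) 1 0 := (hasDerivAt_id 0).const_add q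
  have hsq : HasDerivAt (fun s : ℝ => (q + s) ^ 2) (2 * q) 0 := by simpa using hlin.fun_pow 2
  have hd : HasDerivAt (fun s : ℝ => 1 + 2 * p * (q + s) - 2 * (q + s) ^ 2) (2 * p - 4 * q) 0 :=
    (((hlin.const_mul (2 * p)).const_add 1).fun_sub (hsq.const_mul 2)).congr_deriv (by ring)
  have hne : 2 * p - 4 * q ≠ 0 := by
    have := le_abs_self q
    intro h; linarith
  exact not_isMCriticalPt_of_tubeLine hTS hρF m hGn hx
    (Φ := fun p q => 1 + 2 * p * q - 2 * q ^ 2) hform hne hd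

/-- **The seam-modified normalised presentation is regular on the box.**  If near the tube point
`x` the smooth `f` equals `Gn + τ(p) ψ(σ) (1 - σ - Gn)` with `σ = -2pq`, `Gn = 1 + 2pq - 2q²`,
`τ = seamTaper r₀`, `ψ` a plateau as in `tubeProfile_deriv_pos` (`δ ≤ r₀⁴ / 16`), and
`p(x) > r₀`, `|q(x)| < r₀ / 2`, then `x` is not a critical point of `f`.
[cite: AbramsGayKirby2018, proof of Thm. 5] -/
theorem modified_regular_tube [IsManifold (𝓡 4) ∞ X]
    (hTS : TubeStructure S₀ F u v ρ O Ot rt tp) (hρF : ∀ x ∈ Ot, ρ x ∈ F) (m : Fin 3)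
    {ψ : ℝ → ℝ} (hψd : Differentiable ℝ ψ) (hψ01 : ∀ t, 0 ≤ ψ t ∧ ψ t ≤ 1)
    (hψ1 : ∀ t, |t * deriv ψ t| ≤ 1) {δ : ℝ} (hψδ : ∀ t, δ ≤ t ^ 2 → deriv ψ t = 0)
    {r₀ : ℝ} (hr₀ : 0 < r₀) (hδ : δ ≤ r₀ ^ 4 / 16)
    {f : X → ℝ} (hf : ContMDiff (𝓡 4) 𝓘(ℝ, ℝ) ∞ f) {x : X} (hx : x ∈ Ot)
    (hform : ∀ᶠ y in 𝓝 x, f y =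
      (1 + 2 * pCo m (u y) (v y) * qCo m (u y) (v y) - 2 * qCo m (u y) (v y) ^ 2) +
        seamTaper r₀ (pCo m (u y) (v y)) * ψ (-2 * pCo m (u y) (v y) * qCo m (u y) (v y)) *
          (1 - (-2 * pCo m (u y) (v y) * qCo m (u y) (v y)) -
            (1 + 2 * pCo m (u y) (v y) * qCo m (u y) (v y) - 2 * qCo m (u y) (v y) ^ 2)))
    (hp : r₀ < pCo m (u x) (v x)) (hq : |qCo m (u x) (v x)| < r₀ / 2) :
    ¬ IsMCriticalPt (𝓡 4) f x := by
  have hc : 0 ≤ seamTaper r₀ (pCo m (u x) (v x)) ∧ seamTaper r₀ (pCo m (u x) (v x)) ≤ 1 :=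
    ⟨Real.smoothTransition.nonneg _, Real.smoothTransition.le_one _⟩
  obtain ⟨Φ', hΦ'pos, hΦ'⟩ := tubeProfile_deriv_pos hψd hψ01 hψ1 hψδ hr₀ hδ hp hq hc
  exact not_isMCriticalPt_of_tubeLine hTS hρF m hf hx
    (Φ := fun p q => (1 + 2 * p * q - 2 * q ^ 2) +
      seamTaper r₀ p * ψ (-2 * p * q) * (1 - (-2 * p * q) - (1 + 2 * p * q - 2 * q ^ 2)))
    hform hΦ'pos.ne' hΦ'

end TubeLine

/-! ## The toolkit (a registered helper stub) -/

/-- **The tube toolkit of the seam normalisation** (registered helper stub of the line, proved in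
this file): the wedge descriptions in seam coordinates, corner-slice charts at tube points, and
the regularity of the reference and of the modified normalised presentations in the tube. -/
def SeamFormTubeToolkit : Prop :=
  (∀ (m : Fin 3) (a b r₀ : ℝ), pCo m a b ^ 2 ≤ a ^ 2 + b ^ 2 ∧
    (0 < r₀ → r₀ < pCo m a b → |qCo m a b| < r₀ / 2 → (9 * r₀) ^ 2 ≤ a ^ 2 + b ^ 2 →
      6 * r₀ < pCo m a b) ∧
    (0 < r₀ → 0 ≤ pCo m a b → pCo m a b ≤ r₀ → |qCo m a b| ≤ r₀ / 2 →
      a ^ 2 + b ^ 2 < (4 * r₀) ^ 2)) ∧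
  (∀ (X : Type) [TopologicalSpace X] (m : Fin 3) (u v : X → ℝ), Continuous u → Continuous v →
    (Continuous fun x => pCo m (u x) (v x)) ∧ Continuous fun x => qCo m (u x) (v x)) ∧
  (∀ (X : Type) [TopologicalSpace X] [ChartedSpace (EuclideanSpace ℝ (Fin 4)) X]
    (S : Fin 3 → Set X) (u v : X → ℝ) (ρ : X → X) (U O : Set X) (c : Fin 3 → ℕ → ℕ),
    TriNormalForm S 0 1 2 u v ρ U O c → ∀ (m : Fin 3), ∀ x ∈ U,
      (x ∈ S (refIdx m) ↔ 0 ≤ pCo m (u x) (v x) ∧ 0 ≤ qCo m (u x) (v x)) ∧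
      (x ∈ S (normIdx m) ↔ qCo m (u x) (v x) ≤ 0 ∧ qCo m (u x) (v x) ≤ pCo m (u x) (v x)) ∧
      (x ∈ S (refIdx m) ∩ S (normIdx m) ↔ qCo m (u x) (v x) = 0 ∧ 0 ≤ pCo m (u x) (v x))) ∧
  (∀ (X : Type) [TopologicalSpace X] [ChartedSpace (EuclideanSpace ℝ (Fin 4)) X]
    [IsManifold (𝓡 4) ∞ X] (S₀ F : Set X) (u v : X → ℝ) (ρ : X → X) (O Ot : Set X) (rt : ℝ)
    (tp : X → ℝ → ℝ → X), TubeStructure S₀ F u v ρ O Ot rt tp → (∀ x ∈ Ot, ρ x ∈ F) →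
    ∀ (m : Fin 3) (Gr : X → ℝ), ContMDiff (𝓡 4) 𝓘(ℝ, ℝ) ∞ Gr → ∀ x ∈ Ot,
    (∀ᶠ y in 𝓝 x, Gr y = 1 - 2 * pCo m (u y) (v y) * qCo m (u y) (v y)) →
    pCo m (u x) (v x) ≠ 0 → ¬ IsMCriticalPt (𝓡 4) Gr x) ∧
  (∀ (X : Type) [TopologicalSpace X] [ChartedSpace (EuclideanSpace ℝ (Fin 4)) X]
    [IsManifold (𝓡 4) ∞ X] (S₀ F : Set X) (u v : X → ℝ) (ρ : X → X) (O Ot : Set X) (rt : ℝ)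
    (tp : X → ℝ → ℝ → X), TubeStructure S₀ F u v ρ O Ot rt tp → (∀ x ∈ Ot, ρ x ∈ F) →
    ∀ (m : Fin 3) (Gn : X → ℝ), ContMDiff (𝓡 4) 𝓘(ℝ, ℝ) ∞ Gn → ∀ x ∈ Ot,
    (∀ᶠ y in 𝓝 x, Gn y = 1 + 2 * pCo m (u y) (v y) * qCo m (u y) (v y) - 2 * qCo m (u y) (v y) ^ 2) →
    2 * |qCo m (u x) (v x)| < pCo m (u x) (v x) → ¬ IsMCriticalPt (𝓡 4) Gn x) ∧
  (∀ (X : Type) [TopologicalSpace X] [ChartedSpace (EuclideanSpace ℝ (Fin 4)) X]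
    [IsManifold (𝓡 4) ∞ X] (S₀ F : Set X) (u v : X → ℝ) (ρ : X → X) (O Ot : Set X) (rt : ℝ)
    (tp : X → ℝ → ℝ → X), TubeStructure S₀ F u v ρ O Ot rt tp → (∀ x ∈ Ot, ρ x ∈ F) →
    ∀ (m : Fin 3) (ψ : ℝ → ℝ), Differentiable ℝ ψ → (∀ t, 0 ≤ ψ t ∧ ψ t ≤ 1) →
    (∀ t, |t * deriv ψ t| ≤ 1) → ∀ (δ : ℝ), (∀ t, δ ≤ t ^ 2 → deriv ψ t = 0) →
    ∀ (r₀ : ℝ), 0 < r₀ → δ ≤ r₀ ^ 4 / 16 → ∀ (f : X → ℝ), ContMDiff (𝓡 4) 𝓘(ℝ, ℝ) ∞ f →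
    ∀ x ∈ Ot, (∀ᶠ y in 𝓝 x, f y =
      (1 + 2 * pCo m (u y) (v y) * qCo m (u y) (v y) - 2 * qCo m (u y) (v y) ^ 2) +
        seamTaper r₀ (pCo m (u y) (v y)) * ψ (-2 * pCo m (u y) (v y) * qCo m (u y) (v y)) *
          (1 - (-2 * pCo m (u y) (v y) * qCo m (u y) (v y)) -
            (1 + 2 * pCo m (u y) (v y) * qCo m (u y) (v y) - 2 * qCo m (u y) (v y) ^ 2))) →
    r₀ < pCo m (u x) (v x) → |qCo m (u x) (v x)| < r₀ / 2 → ¬ IsMCriticalPt (𝓡 4) f x)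

/-- **Registered helper stub `stub_seamFormTubeToolkit`** of line `lp-by-sphere-system-surgery`
(tube toolkit for the seam normalisation `stub_seamForm`). [cite: AbramsGayKirby2018, proof of Thm. 5] -/
theorem stub_seamFormTubeToolkit : SeamFormTubeToolkit :=
  ⟨fun m a b _ => ⟨pCo_sq_le m a b, fun hr₀ hp hq hab => six_lt_pCo hr₀ hp hq hab,
      fun hr₀ hp0 hp hq => normSq_lt_of_pCo_le hr₀ hp0 hp hq⟩,
    fun _ _ m _ _ hu hv => ⟨continuous_pCo_comp m hu hv, continuous_qCo_comp m hu hv⟩,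
    fun _ _ _ _ _ _ _ _ _ _ hT m _ hx => ⟨mem_ref_iff hT m hx, mem_norm_iff hT m hx, mem_seam_iff hT m hx⟩,
    fun _ _ _ _ _ _ _ _ _ _ _ _ _ hTS hρF m _ hGr _ hx hform hp =>
      sigma_regular_tube hTS hρF m hGr hx hform hp,
    fun _ _ _ _ _ _ _ _ _ _ _ _ _ hTS hρF m _ hGn _ hx hform hpq =>
      norm_regular_tube hTS hρF m hGn hx hform hpq,
    fun _ _ _ _ _ _ _ _ _ _ _ _ _ hTS hρF m _ hψd hψ01 hψ1 _ hψδ _ hr₀ hδ _ hf _ hx hform hp hq =>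
      modified_regular_tube hTS hρF m hψd hψ01 hψ1 hψδ hr₀ hδ hf hx hform hp hq⟩

end Summit.SmoothPoincare4.SmoothPoincare4.Cruxes.AgkCor6Sufficiency.LpBySphereSystemSurgery

end
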